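import Literature.AlgebraicGeometry.HodgeTheory.PrimitiveClassesKunnethClebschGordan
import Literature.Algebra.Lie.LefschetzModuleClebschGordanMap
import Literature.Algebra.Lie.LefschetzModuleTensorMultiplicities
import Literature.Algebra.Lie.LefschetzModuleLinearEquiv
import HarnessLib

/-!
# André's canonical isomorphism `P•(X × Y) ≅ ⊕ P•(X) ⊗ P•(Y)`: the Clebsch–Gordan decomposition
# `P_{−k}(M ⊗ N) = ⊕_{a+b−2s = k} Ψ_{a,b,s}(P_{−a}(M) ⊗ P_{−b}(N))` of two Lefschetz modules, and on `H•((Y × Z)(ℂ); ℂ)`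

Family `hodge`, lane `lit-hodgefound` (Track 2 foundations library), layer `Literature/AlgebraicGeometry/HodgeTheory` (with the
abstract §1–§2 in namespace `Literature.Algebra.Lie`, next to their only carrier, as in the seat's
`PrimitiveClassesKunnethClebschGordan.lean`); prover seat `lit-hodgefound-p21` (generation 38, row g38-#3), the assembly of
g38-#1 `Algebra/Lie/LefschetzModuleTensorMultiplicities` (the multiplicities `dim P_{−k}(M ⊗ N) = Σ_{|a−b| ≤ k ≤ a+b, k ≡ a+b}
dim P_{−a} dim P_{−b}`), g38-#2 `Algebra/Lie/LefschetzModuleClebschGordanMap` (the maps `Ψ_{a,b,s}`, injective for `s ≤ min(a,b)`, with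
independent images) and g37-#6 `HodgeTheory/PrimitiveClassesKunnethClebschGordan` (`v_s ∈ P_{−(a+b−2s)}(M ⊗ N)`).  THEOREMS ONLY
(no definition, no named fact, no instance; D-0026 net debt `0`).  This closes the scope notes of `LefschetzModuleWeylOperatorTensor`
and `LefschetzOperatorsKunneth` («the Clebsch–Gordan decomposition `P•(X × Y) ≅ ⊕ P•(X) ⊗ P•(Y)` itself» was not formalised).

## Source, VERBATIM (Y. André, *Pour une théorie inconditionnelle des motifs*, Publ. Math. IHÉS 83 (1996), §1.3 p. 12 = held
`paper:doi-10-1007-bf02698643` p0009 L38–L43)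

«L'isomorphisme (d'algèbres graduées) de Künneth : `H•(X × Y) ≅ H•(X) ⊗ H•(Y)` devient un isomorphisme de `𝔰𝔩₂`-modules si l'on
munit `X × Y` du faisceau inversible ample `p_X^* 𝓛_X ⊗ p_Y^* 𝓛_Y`.  Par le formalisme des `𝔰𝔩₂`-triplets (cf. [D80] 1.6.12.1, avec le
dictionnaire `N = ᶜΛ`, `Gr_i = H^{d−i}(X)`, `P_{−i} = P^{d−i}(X)`), on déduit de l'isomorphisme de `𝔰𝔩₂`-représentations
`Sⁱ ⊗ Sʲ ≅ ⊕_k S^{i+j−2k}` (Clebsch–Gordan) un isomorphisme canonique : `P•(X × Y) ≅ ⊕ … P•(X) ⊗ P•(Y)`; l'inclusion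
`P•(X) ⊗ P•(Y) ⊆ P•(X × Y)` fournie par cet isomorphisme est restriction de l'isomorphisme de Künneth.»

Supporting: J. E. Humphreys, GTM 9 [Humphreys1972], §22.5 Exercise 7 (p. 126; held text p0170 L3): «If `n ≤ m`, then `V(m) ⊗ V(n) ≅
V(m+n) ⊕ V(m+n−2) ⊕ … ⊕ V(m−n)`, `n+1` summands in all»; W. Fulton, J. Harris, GTM 129 [FultonHarrisGTM129], §11.1 and Exercise 11.11
(held text p0186 L1–L20); E. Looijenga, V. A. Lunts [LooijengaLunts1997], §1 (1.1) p. 4 (tensor products of Lefschetz modules);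
A. Hatcher [HatcherAT2002], §3.2 Thm. 3.16 (Künneth).

## Rendering

`X`, `Y` ↦ Lefschetz modules `(M, h, e)`, `(N, h', e')` (finite-dimensional, characteristic `0`; on the carriers `M = H•(Y(ℂ); ℂ)` with
`h = h_m`, `e = L_η`), `H•(X × Y)` ↦ `M ⊗ N` with `H = h ⊗ 1 + 1 ⊗ h'`, `E = e ⊗ 1 + 1 ⊗ e'` (transported to `H•((Y × Z)(ℂ); ℂ)`
along the Künneth isomorphism `κ = kunnethEquiv`, which intertwines `H`, `E` with `h_{m+n}`, `L_θ`, `θ = pr_Y^* η + pr_Z^* η'`);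
the summand «`P^{d−a}(X) ⊗ P^{d'−b}(Y) ⊂ P•(X × Y)` through `S^{a+b−2s} ⊂ Sᵃ ⊗ Sᵇ`» ↦ the image of the Clebsch–Gordan map
`Ψ_{a,b,s} : P_{−a}(M) ⊗ P_{−b}(N) → M ⊗ N` (g38-#2 `clebschGordanMap`); for `P_{−k}(M ⊗ N)` the summands are indexed by the pairs
`(a, b)` with `|a − b| ≤ k ≤ a + b`, `k ≡ a + b (mod 2)` (`s = (a + b − k)/2`), `a < D`, `b < D'` for any `D ≥ dim M`, `D' ≥ dim N`.

## WHAT IS PROVED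

* §1 (abstract) `HasLefschetzProperty.range_clebschGordanMap_le_primitiveSpace` (`Ψ_{a,b,s}(P_{−a} ⊗ P_{−b}) ⊆ P_{−(a+b−2s)}(M ⊗ N)`,
  `2s ≤ a + b`), **`HasLefschetzProperty.biSup_range_clebschGordanMap_eq_primitiveSpace`** (THE DECOMPOSITION
  `⨆_{(a,b)} Ψ_{a,b,(a+b−k)/2}(P_{−a} ⊗ P_{−b}) = P_{−k}(M ⊗ N)`, an independent supremum by g38-#2: inclusion by §1, equality by
  g38-#1's count), `HasLefschetzProperty.exists_sum_clebschGordanMap_eq` (every `x ∈ P_{−k}(M ⊗ N)` is a sum of the summands),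
  `HasLefschetzProperty.clebschGordan_sum_unique` (… uniquely: the components are determined).
* §2 (carriers; `Y`, `Z` smooth projective of dimensions `m`, `n`, `m + n > 0`, `η`, `η'` hard Lefschetz classes,
  `θ = pr_Y^* η + pr_Z^* η'`): **`primitiveSpace_prod_eq_biSup_map_kunnethCross`** — in `H•((Y × Z)(ℂ); ℂ)`, the `θ`-primitive
  classes of weight `−k` are the (independent) sum over `(a, b)` of the Künneth images `κ(Ψ_{a,b,(a+b−k)/2}(Pₐ(Y) ⊗ P_b(Z)))`,
  `Pₐ(Y)` = the `η`-primitive classes of weight `−a` in `H•(Y(ℂ); ℂ)`; `iSupIndep_map_kunnethCross_range_clebschGordanMap` (the Künneth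
  images are independent); `exists_sum_kunnethCross_clebschGordanMap_eq` (every primitive class of `Y × Z` is such a sum).

## References

* [Andre1996Motifs] Y. André, Publ. Math. IHÉS 83 (1996), §1.3 (p. 12).
* [Humphreys1972] J. E. Humphreys, *Introduction to Lie Algebras and Representation Theory*, §22.5 Exercise 7 (p. 126).
* [FultonHarrisGTM129] W. Fulton, J. Harris, *Representation Theory* (GTM 129), §11.1, Exercise 11.11.
* [LooijengaLunts1997] E. Looijenga, V. A. Lunts, Invent. Math. 129 (1997), §1 (1.1) p. 4.
* [HatcherAT2002] A. Hatcher, *Algebraic Topology* (2002), §3.2 Thm. 3.16.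
-/

noncomputable section

open scoped TensorProduct

/-! ### §1 The Clebsch–Gordan decomposition of `P_{−k}(M ⊗ N)` -/

namespace Literature.Algebra.Lie

open Module Function Set
open HasLefschetzProperty (primitiveSpace mem_primitiveSpace_iff)

section Abstract

variable {K : Type*} [Field K] [CharZero K] {M N : Type*} [AddCommGroup M] [Module K M] [FiniteDimensional K M]
  [AddCommGroup N] [Module K N] [FiniteDimensional K N] {h e : Module.End K M} {h' e' : Module.End K N}

omit [CharZero K] [FiniteDimensional K M] [FiniteDimensional K N] in
/-- The dimension of a finite independent supremum is the sum of the dimensions. [folklore] -/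
private theorem finrank_biSup_eq_sum_of_iSupIndep {ι : Type*} {V : Type*} [AddCommGroup V] [Module K V] [FiniteDimensional K V]
    {W : ι → Submodule K V} (hW : iSupIndep W) (s : Finset ι) :
    finrank K (⨆ i ∈ s, W i : Submodule K V) = ∑ i ∈ s, finrank K (W i) := by
  classical
  induction s using Finset.induction_on with
  | empty => simp
  | insert a s ha ih =>
    rw [Finset.iSup_insert, Finset.sum_insert ha, ← ih]
    have hdis : Disjoint (W a) (⨆ i ∈ s, W i) := by
      have h1 := hW.disjoint_biSup (y := (s : Set ι)) (x := a) (by exact_mod_cast ha)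
      simpa only [Finset.mem_coe] using h1
    rw [← Submodule.finrank_sup_add_finrank_inf_eq, hdis.eq_bot, finrank_bot, add_zero]

/-- **`Ψ_{a,b,s}(P_{−a}(M) ⊗ P_{−b}(N)) ⊆ P_{−(a+b−2s)}(M ⊗ N)` for `2s ≤ a + b`** (`H = h ⊗ 1 + 1 ⊗ h' ≠ 0`): the values `v_s(p, q)` are
lowest-weight vectors of weight `−(a + b − 2s)` (the seat's `sum_smul_pow_tmul_pow_mem_primitiveSpace`) — «l'inclusion
`P•(X) ⊗ P•(Y) ⊆ P•(X × Y)`» for `s = 0` and its companions for `s > 0`. [cite: Andre1996Motifs, §1.3 (p. 12)]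
[cite: Humphreys1972, §22.5 Exercise 7 (p. 126)] -/
theorem HasLefschetzProperty.range_clebschGordanMap_le_primitiveSpace (L : HasLefschetzProperty h e) (hgr : IsZGrading h)
    (L' : HasLefschetzProperty h' e') (hgr' : IsZGrading h') (h0 : h.rTensor N + h'.lTensor M ≠ 0) {a b s : ℕ}
    (hs : 2 * s ≤ a + b) :
    LinearMap.range (clebschGordanMap h e h' e' a b s) ≤
      primitiveSpace (h.rTensor N + h'.lTensor M) (e.rTensor N + e'.lTensor M) (a + b - 2 * s) := by
  rintro _ ⟨x, rfl⟩
  induction x using TensorProduct.induction_on with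
  | zero => rw [map_zero]; exact Submodule.zero_mem _
  | add x y hx hy => rw [map_add]; exact Submodule.add_mem _ hx hy
  | tmul p q =>
    rw [clebschGordanMap_tmul]
    exact sum_smul_pow_tmul_pow_mem_primitiveSpace L hgr L' hgr' h0 hs p.2 q.2

/-- **THE CLEBSCH–GORDAN DECOMPOSITION `P_{−k}(M ⊗ N) = ⊕_{(a,b)} Ψ_{a,b,(a+b−k)/2}(P_{−a}(M) ⊗ P_{−b}(N))`**, the supremum over the
pairs `(a, b)`, `a < D`, `b < D'` (`D ≥ dim M`, `D' ≥ dim N`), with `|a − b| ≤ k ≤ a + b` and `k ≡ a + b (mod 2)` — an INDEPENDENT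
supremum (g38-#2 `iSupIndep_range_clebschGordanMap`) of subspaces of dimensions `dim P_{−a} · dim P_{−b}`: «on déduit de
l'isomorphisme de `𝔰𝔩₂`-représentations `Sⁱ ⊗ Sʲ ≅ ⊕_k S^{i+j−2k}` (Clebsch–Gordan) un isomorphisme canonique
`P•(X × Y) ≅ ⊕ P•(X) ⊗ P•(Y)`».  Proof: `⊆` summand-wise (`range_clebschGordanMap_le_primitiveSpace`); equality of dimensions by
g38-#1's multiplicity formula. [cite: Andre1996Motifs, §1.3 (p. 12)] [cite: Humphreys1972, §22.5 Exercise 7 (p. 126; held text p0170 L3)]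
[cite: FultonHarrisGTM129, §11.1 Exercise 11.11 (held text p0186 L18–L20)] -/
theorem HasLefschetzProperty.biSup_range_clebschGordanMap_eq_primitiveSpace (L : HasLefschetzProperty h e) (hgr : IsZGrading h)
    (L' : HasLefschetzProperty h' e') (hgr' : IsZGrading h') (h0 : h.rTensor N + h'.lTensor M ≠ 0) {D D' : ℕ}
    (hD : finrank K M ≤ D) (hD' : finrank K N ≤ D') (k : ℕ) :
    ⨆ ab ∈ (Finset.range D ×ˢ Finset.range D').filter
        (fun ab : ℕ × ℕ ↦ ab.1 ≤ ab.2 + k ∧ ab.2 ≤ ab.1 + k ∧ k ≤ ab.1 + ab.2 ∧ (ab.1 + ab.2 + k) % 2 = 0),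
      LinearMap.range (clebschGordanMap h e h' e' ab.1 ab.2 ((ab.1 + ab.2 - k) / 2)) =
      primitiveSpace (h.rTensor N + h'.lTensor M) (e.rTensor N + e'.lTensor M) k := by
  classical
  apply Submodule.eq_of_le_of_finrank_eq
  · refine iSup₂_le fun ab hab ↦ ?_
    obtain ⟨-, h₁, h₂, h₃, h₄⟩ := Finset.mem_filter.1 hab
    exact (L.range_clebschGordanMap_le_primitiveSpace hgr L' hgr' h0 (by omega)).trans_eq
      (congrArg (primitiveSpace (h.rTensor N + h'.lTensor M) (e.rTensor N + e'.lTensor M)) (by omega))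
  · rw [finrank_biSup_eq_sum_of_iSupIndep (L.iSupIndep_range_clebschGordanMap hgr L' hgr' fun a b ↦ (a + b - k) / 2),
      L.finrank_primitiveSpace_tensor hgr L' hgr' hD hD' k, Finset.sum_filter, ← Finset.sum_product']
    refine Finset.sum_congr rfl fun ab _ ↦ ?_
    split_ifs with hP
    · exact L'.finrank_range_clebschGordanMap hgr' (by omega) (by omega)
    · rfl

/-- **Every `x ∈ P_{−k}(M ⊗ N)` is a sum `x = Σ_{(a,b)} y_{a,b}` with `y_{a,b} ∈ Ψ_{a,b,(a+b−k)/2}(P_{−a}(M) ⊗ P_{−b}(N))`** (existence of the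
Clebsch–Gordan components). [cite: Andre1996Motifs, §1.3 (p. 12)] [cite: Humphreys1972, §22.5 Exercise 7 (p. 126)] -/
theorem HasLefschetzProperty.exists_sum_clebschGordanMap_eq (L : HasLefschetzProperty h e) (hgr : IsZGrading h)
    (L' : HasLefschetzProperty h' e') (hgr' : IsZGrading h') (h0 : h.rTensor N + h'.lTensor M ≠ 0) {D D' : ℕ}
    (hD : finrank K M ≤ D) (hD' : finrank K N ≤ D') {k : ℕ} {x : M ⊗[K] N}
    (hx : x ∈ primitiveSpace (h.rTensor N + h'.lTensor M) (e.rTensor N + e'.lTensor M) k) :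
    ∃ y : ℕ × ℕ → M ⊗[K] N,
      (∀ ab, y ab ∈ LinearMap.range (clebschGordanMap h e h' e' ab.1 ab.2 ((ab.1 + ab.2 - k) / 2))) ∧
        ∑ ab ∈ (Finset.range D ×ˢ Finset.range D').filter
          (fun ab : ℕ × ℕ ↦ ab.1 ≤ ab.2 + k ∧ ab.2 ≤ ab.1 + k ∧ k ≤ ab.1 + ab.2 ∧ (ab.1 + ab.2 + k) % 2 = 0), y ab = x := by
  classical
  rw [← L.biSup_range_clebschGordanMap_eq_primitiveSpace hgr L' hgr' h0 hD hD' k,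
    Submodule.mem_iSup_finset_iff_exists_sum] at hx
  obtain ⟨μ, hμ⟩ := hx
  exact ⟨fun ab ↦ (μ ab : M ⊗[K] N), fun ab ↦ (μ ab).2, hμ⟩

/-- **… and the components are unique**: if `Σ_{(a,b) ∈ s} y_{a,b} = Σ_{(a,b) ∈ s} y'_{a,b}` with `y_{a,b}, y'_{a,b} ∈ Ψ_{a,b,σ(a,b)}(P_{−a} ⊗ P_{−b})`
then `y = y'` on `s` (independence of the summands, g38-#2) — with `exists_sum_clebschGordanMap_eq` and the injectivity of the `Ψ_{a,b,s}`
this is the canonical isomorphism `P_{−k}(M ⊗ N) ≅ ⊕ P_{−a}(M) ⊗ P_{−b}(N)`. [cite: Andre1996Motifs, §1.3 (p. 12)]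
[cite: Humphreys1972, §22.5 Exercise 7 (p. 126)] -/
theorem HasLefschetzProperty.clebschGordan_sum_unique (L : HasLefschetzProperty h e) (hgr : IsZGrading h)
    (L' : HasLefschetzProperty h' e') (hgr' : IsZGrading h') (σ : ℕ → ℕ → ℕ) {s : Finset (ℕ × ℕ)} {y y' : ℕ × ℕ → M ⊗[K] N}
    (hy : ∀ ab ∈ s, y ab ∈ LinearMap.range (clebschGordanMap h e h' e' ab.1 ab.2 (σ ab.1 ab.2)))
    (hy' : ∀ ab ∈ s, y' ab ∈ LinearMap.range (clebschGordanMap h e h' e' ab.1 ab.2 (σ ab.1 ab.2)))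
    (heq : ∑ ab ∈ s, y ab = ∑ ab ∈ s, y' ab) : ∀ ab ∈ s, y ab = y' ab := by
  classical
  have hind := L.iSupIndep_range_clebschGordanMap hgr L' hgr' σ
  intro ab₀ h₀
  have h1 : y ab₀ - y' ab₀ ∈ LinearMap.range (clebschGordanMap h e h' e' ab₀.1 ab₀.2 (σ ab₀.1 ab₀.2)) :=
    Submodule.sub_mem _ (hy ab₀ h₀) (hy' ab₀ h₀)
  have h2 : ∑ ab ∈ s, (y ab - y' ab) = 0 := by rw [Finset.sum_sub_distrib, heq, sub_self]
  rw [← Finset.add_sum_erase s _ h₀, add_eq_zero_iff_eq_neg] at h2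
  have h3 : y ab₀ - y' ab₀ ∈ ⨆ ab ∈ ((s.erase ab₀ : Finset (ℕ × ℕ)) : Set (ℕ × ℕ)),
      LinearMap.range (clebschGordanMap h e h' e' ab.1 ab.2 (σ ab.1 ab.2)) := by
    rw [h2]
    refine Submodule.neg_mem _ (Submodule.sum_mem _ fun ab hab ↦ ?_)
    exact Submodule.mem_iSup_of_mem (p := fun ab : ℕ × ℕ ↦ ⨆ (_ : ab ∈ ((s.erase ab₀ : Finset (ℕ × ℕ)) : Set (ℕ × ℕ))),
      LinearMap.range (clebschGordanMap h e h' e' ab.1 ab.2 (σ ab.1 ab.2))) ab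
      (Submodule.mem_iSup_of_mem (Finset.mem_coe.2 hab) (Submodule.sub_mem _ (hy ab (Finset.mem_of_mem_erase hab))
        (hy' ab (Finset.mem_of_mem_erase hab))))
  have hdis := hind.disjoint_biSup (y := ((s.erase ab₀ : Finset (ℕ × ℕ)) : Set (ℕ × ℕ))) (x := ab₀)
    (by rw [Finset.mem_coe]; exact Finset.notMem_erase ab₀ s)
  exact sub_eq_zero.1 ((Submodule.disjoint_def.1 hdis) _ h1 h3)

end Abstract

end Literature.Algebra.Lie

/-! ### §2 On `H•((Y × Z)(ℂ); ℂ)`: André's canonical isomorphism `P•(Y × Z) ≅ ⊕ P•(Y) ⊗ P•(Z)` -/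

namespace Literature.AlgebraicGeometry.HodgeTheory

open CategoryTheory MonoidalCategory CartesianMonoidalCategory
open Literature.AlgebraicTopology.SingularHomology
open Literature.AlgebraicGeometry.Motives
open Literature.AlgebraicGeometry.Hyperkaehler
open Literature.Geometry.Kaehler
open Literature.Algebra.Lie
open Literature.Algebra.Lie.HasLefschetzProperty (primitiveSpace mem_primitiveSpace_iff)

variable {m n : ℕ} {Y Z : SchemeOver ℂ}

/-- The Künneth isomorphism as a linear map is the cross map. [cite: HatcherAT2002, §3.2 Thm. 3.16] -/
private theorem coe_kunnethEquiv (hY : IsSmoothProjective m Y) (hZ : IsSmoothProjective n Z) :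
    ((kunnethEquiv hY hZ : totalCohomology ℂ (ComplexPoints Y) ⊗[ℂ] totalCohomology ℂ (ComplexPoints Z) ≃ₗ[ℂ]
        totalCohomology ℂ (ComplexPoints (Y ⊗ Z))) :
      totalCohomology ℂ (ComplexPoints Y) ⊗[ℂ] totalCohomology ℂ (ComplexPoints Z) →ₗ[ℂ]
        totalCohomology ℂ (ComplexPoints (Y ⊗ Z))) = kunnethCross Y Z :=
  LinearMap.ext fun x ↦ kunnethEquiv_apply hY hZ x

/-- **ANDRÉ'S CANONICAL ISOMORPHISM ON THE CARRIERS.**  For `Y`, `Z` smooth projective over `ℂ` of dimensions `m`, `n` (`m + n > 0`),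
hard Lefschetz classes `η ∈ H²(Y(ℂ); ℂ)`, `η' ∈ H²(Z(ℂ); ℂ)`, `θ = pr_Y^* η + pr_Z^* η'`, and any `D ≥ dim H•(Y(ℂ); ℂ)`,
`D' ≥ dim H•(Z(ℂ); ℂ)`: in `H•((Y × Z)(ℂ); ℂ)` the space of `θ`-primitive classes of weight `−k` (for `h_{m+n}`, `L_θ`) is the sum — an
independent one, `iSupIndep_map_kunnethCross_range_clebschGordanMap` — over the pairs `(a, b)` with `|a − b| ≤ k ≤ a + b`,
`k ≡ a + b (mod 2)` of the Künneth images `Σ_l c_l · pr_Y^*(L_ηˡ p) ⌣ pr_Z^*(L_{η'}^{s−l} q)` (`s = (a + b − k)/2`, `p` `η`-primitive of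
weight `−a`, `q` `η'`-primitive of weight `−b`): «on déduit de l'isomorphisme de `𝔰𝔩₂`-représentations `Sⁱ ⊗ Sʲ ≅ ⊕_k S^{i+j−2k}`
(Clebsch–Gordan) un isomorphisme canonique `P•(X × Y) ≅ ⊕ P•(X) ⊗ P•(Y)`; l'inclusion … est restriction de l'isomorphisme de Künneth».
(§1 for the Lefschetz modules `H•(Y(ℂ); ℂ)`, `H•(Z(ℂ); ℂ)`, transported along the Künneth isomorphism, which intertwines the
operators — `kunnethEquiv_conj_degreeOperator`, `kunnethEquiv_conj_totalLefschetz`.) [cite: Andre1996Motifs, §1.3 (p. 12)]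
[cite: HatcherAT2002, §3.2 Thm. 3.16] [cite: LooijengaLunts1997, §1 (1.1) p. 4] -/
theorem primitiveSpace_prod_eq_biSup_map_kunnethCross (hY : IsSmoothProjective m Y) (hZ : IsSmoothProjective n Z)
    {η : complexBetti Y 2} {η' : complexBetti Z 2} (hη : HasHardLefschetzProperty η m)
    (hη' : HasHardLefschetzProperty η' n) (hmn : 0 < m + n) {D D' : ℕ}
    (hD : Module.finrank ℂ (totalCohomology ℂ (ComplexPoints Y)) ≤ D)
    (hD' : Module.finrank ℂ (totalCohomology ℂ (ComplexPoints Z)) ≤ D') (k : ℕ) :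
    primitiveSpace (degreeOperator ℂ (ComplexPoints (Y ⊗ Z)) (m + n))
        (totalLefschetz (complexBetti.map (fst Y Z) 2 η + complexBetti.map (snd Y Z) 2 η')) k =
      ⨆ ab ∈ (Finset.range D ×ˢ Finset.range D').filter
          (fun ab : ℕ × ℕ ↦ ab.1 ≤ ab.2 + k ∧ ab.2 ≤ ab.1 + k ∧ k ≤ ab.1 + ab.2 ∧ (ab.1 + ab.2 + k) % 2 = 0),
        (LinearMap.range (clebschGordanMap (degreeOperator ℂ (ComplexPoints Y) m) (totalLefschetz η)
          (degreeOperator ℂ (ComplexPoints Z) n) (totalLefschetz η') ab.1 ab.2 ((ab.1 + ab.2 - k) / 2))).map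
          (kunnethCross Y Z) := by
  haveI := finite_totalCohomology hY
  haveI := finite_totalCohomology hZ
  have h1 := (hasLefschetzProperty_complexPoints hY hη).biSup_range_clebschGordanMap_eq_primitiveSpace
    (isZGrading_degreeOperator m) (hasLefschetzProperty_complexPoints hZ hη') (isZGrading_degreeOperator n)
    (degreeOperator_tensor_ne_zero hY hZ hmn) hD hD' k
  rw [← coe_kunnethEquiv hY hZ]
  simp only [← Submodule.map_iSup]
  rw [h1, map_primitiveSpace_conj, kunnethEquiv_conj_degreeOperator, kunnethEquiv_conj_totalLefschetz]

/-- **The Künneth images of the Clebsch–Gordan summands are independent in `H•((Y × Z)(ℂ); ℂ)`** (the Künneth map is injective).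
[cite: Andre1996Motifs, §1.3 (p. 12)] [cite: HatcherAT2002, §3.2 Thm. 3.16] -/
theorem iSupIndep_map_kunnethCross_range_clebschGordanMap (hY : IsSmoothProjective m Y) (hZ : IsSmoothProjective n Z)
    {η : complexBetti Y 2} {η' : complexBetti Z 2} (hη : HasHardLefschetzProperty η m)
    (hη' : HasHardLefschetzProperty η' n) (σ : ℕ → ℕ → ℕ) :
    iSupIndep fun ab : ℕ × ℕ ↦ (LinearMap.range (clebschGordanMap (degreeOperator ℂ (ComplexPoints Y) m) (totalLefschetz η)
      (degreeOperator ℂ (ComplexPoints Z) n) (totalLefschetz η') ab.1 ab.2 (σ ab.1 ab.2))).map (kunnethCross Y Z) := by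
  haveI := finite_totalCohomology hY
  haveI := finite_totalCohomology hZ
  have h1 := (hasLefschetzProperty_complexPoints hY hη).iSupIndep_range_clebschGordanMap (isZGrading_degreeOperator m)
    (hasLefschetzProperty_complexPoints hZ hη') (isZGrading_degreeOperator n) σ
  exact LinearMap.iSupIndep_map (kunnethCross Y Z) (kunnethCross_bijective hY hZ).1 h1

/-- **Every `θ`-primitive class of `Y × Z` of weight `−k` is a sum of Künneth images of Clebsch–Gordan vectors
`Σ_l c_l · L_ηˡ p ⊗ L_{η'}^{s−l} q`** (`(a, b)` as above, `s = (a + b − k)/2`). [cite: Andre1996Motifs, §1.3 (p. 12)] [cite: HatcherAT2002, §3.2 Thm. 3.16] -/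
theorem exists_sum_kunnethCross_clebschGordanMap_eq (hY : IsSmoothProjective m Y) (hZ : IsSmoothProjective n Z)
    {η : complexBetti Y 2} {η' : complexBetti Z 2} (hη : HasHardLefschetzProperty η m)
    (hη' : HasHardLefschetzProperty η' n) (hmn : 0 < m + n) {D D' : ℕ}
    (hD : Module.finrank ℂ (totalCohomology ℂ (ComplexPoints Y)) ≤ D)
    (hD' : Module.finrank ℂ (totalCohomology ℂ (ComplexPoints Z)) ≤ D') {k : ℕ}
    {x : totalCohomology ℂ (ComplexPoints (Y ⊗ Z))}
    (hx : x ∈ primitiveSpace (degreeOperator ℂ (ComplexPoints (Y ⊗ Z)) (m + n))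
      (totalLefschetz (complexBetti.map (fst Y Z) 2 η + complexBetti.map (snd Y Z) 2 η')) k) :
    ∃ y : ℕ × ℕ → totalCohomology ℂ (ComplexPoints Y) ⊗[ℂ] totalCohomology ℂ (ComplexPoints Z),
      (∀ ab, y ab ∈ LinearMap.range (clebschGordanMap (degreeOperator ℂ (ComplexPoints Y) m) (totalLefschetz η)
        (degreeOperator ℂ (ComplexPoints Z) n) (totalLefschetz η') ab.1 ab.2 ((ab.1 + ab.2 - k) / 2))) ∧
      ∑ ab ∈ (Finset.range D ×ˢ Finset.range D').filter
          (fun ab : ℕ × ℕ ↦ ab.1 ≤ ab.2 + k ∧ ab.2 ≤ ab.1 + k ∧ k ≤ ab.1 + ab.2 ∧ (ab.1 + ab.2 + k) % 2 = 0),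
        kunnethCross Y Z (y ab) = x := by
  classical
  haveI := finite_totalCohomology hY
  haveI := finite_totalCohomology hZ
  rw [primitiveSpace_prod_eq_biSup_map_kunnethCross hY hZ hη hη' hmn hD hD' k, Submodule.mem_iSup_finset_iff_exists_sum] at hx
  obtain ⟨μ, hμ⟩ := hx
  have hμ' : ∀ ab, ∃ y, y ∈ LinearMap.range (clebschGordanMap (degreeOperator ℂ (ComplexPoints Y) m) (totalLefschetz η)
      (degreeOperator ℂ (ComplexPoints Z) n) (totalLefschetz η') ab.1 ab.2 ((ab.1 + ab.2 - k) / 2)) ∧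
      kunnethCross Y Z y = (μ ab : totalCohomology ℂ (ComplexPoints (Y ⊗ Z))) := fun ab ↦
    Submodule.mem_map.1 (μ ab).2
  choose y hy hyμ using hμ'
  exact ⟨y, hy, by rw [← hμ]; exact Finset.sum_congr rfl fun ab _ ↦ hyμ ab⟩

end Literature.AlgebraicGeometry.HodgeTheory

end
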